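import Mathlib.LinearAlgebra.PiTensorProduct.Basis
import Mathlib.LinearAlgebra.Matrix.ToLin
import Mathlib.Algebra.BigOperators.Fin
import Mathlib.Algebra.BigOperators.Ring.Finset
import Mathlib.Data.Fin.Tuple.Basic
import Mathlib.Algebra.Algebra.Rat
import Mathlib.Algebra.Order.Field.Power
import Mathlib.LinearAlgebra.FiniteDimensional.Lemmas
import Literature.NumberTheory.DiophantineGeometry.SchurWeylPlethysm
import HarnessLib

/-!
# The coordinate ("words") model of the tensor power `(k^N)^{⊗m}`
(trunk ArithGeomL / CplxAlg; infrastructure for the proof of `hwMultiplicity_glTensorRep`)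

The tensor power `(k^N)^{⊗m}` has the basis `e_w = e_{w 0} ⊗ ⋯ ⊗ e_{w (m-1)}` indexed by *words*
`w : Fin m → Fin N` (Mathlib's `Basis.piTensorProduct` of the standard bases). In these
coordinates the diagonal action `glTensorRep` of `g ∈ GL_N(k)` is the `m`-th Kronecker power of
the matrix `g`:
`(g · c)(w') = ∑_w (∏_p g_{w' p, w p}) c(w)`  (`wordRep`, `wordRep_apply`),
and `wordRepEquiv` is the resulting equivalence of representations
`glTensorRep (Fin N) k m ≃ wordRep k N m`, so that highest-weight multiplicities may be computed
in the model (`hwMultiplicity_glTensorRep_eq_wordRep`).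

We then record the elementary representation theory of the model that the proof of Schur–Weyl
duality (multiplicity form, file `SchurWeylMultiplicityProofs`) uses:

* the *content* `wordContent w` of a word (how often each letter occurs) and the action of
  diagonal matrices (`wordRep_diagonal_apply`); in characteristic zero a weight vector of weight
  `χ` is supported on words of content `χ` (`apply_eq_zero_of_mem_weightSpace`), so a
  highest-weight space of a weight with a negative entry vanishes
  (`highestWeightSpace_wordRep_eq_bot_of_neg`);
* the action `wordPerm` of `S_m` permuting positions, which commutes with `GL_N`
  (`wordPerm_wordRep`) and hence preserves highest-weight spaces;
* the *components* `wordComp i c` of a vector along the last tensor factor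
  (`c = ∑_i (wordComp i c) ⊗ e_i`), the formula
  `wordComp a (g · c) = ∑_i g_{a i} • g · wordComp i c` (`wordComp_wordRep`), and the resulting
  **Pieri inequality** for highest-weight vectors (upper triangular Borel):
  `dim HW_χ((k^N)^{⊗(m+1)}) ≤ ∑_r dim HW_{χ - ε_r}((k^N)^{⊗m})`
  (`finrank_highestWeightSpace_succ_le`): if `r` is the largest index with `wordComp r c ≠ 0`
  then `wordComp r c` is a highest-weight vector of weight `χ - ε_r`.

## Sources

* W. Fulton, *Young Tableaux*, LMS Student Texts 35 (1997), §8.1 (the basis `e_T`/words of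
  `E^{⊗n}`, formula for the action), §8.3.
* R. Goodman, N. Wallach, *Symmetry, Representations, and Invariants*, GTM 255 (2009), §9.1.1
  (tensor powers in coordinates), Cor. 3.2.3.
* The Pieri inequality is the highest-weight-vector form of Pieri's formula
  `V(χ) ⊗ V ≅ ⊕_r V(χ + ε_r)` read backwards (Fulton–Harris, GTM 129, (6.8) and Ex. 6.12);
  the filtration argument given here is elementary and self-contained.

## Mathlib

Used: `Basis.piTensorProduct` (`piTensorProduct_repr_tprod_apply`), `Pi.basisFun`,
`Basis.equivFun`, `Matrix.mulVecLin` (`mulVecLin_one`, `mulVecLin_mul`), `Fintype.prod_sum`,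
`Fin.snocEquiv`, `Fin.prod_univ_castSucc`, `Representation.Equiv.mk`,
`LinearMap.finrank_range_add_finrank_ker`, `Submodule.finrank_mono`. Mathlib has no tensor-power
representation of `GL_n` in coordinates.

## Design

Everything lives in `namespace Literature.CplxAlg`. `Word N m = Fin m → Fin N`; the model space is the
function space `Word N m → k` (finite-dimensional, so all `finrank`s below are honest). The
representation `wordRep` is defined for a commutative ring `k` through the monoid homomorphism
`tensorPowerMatrix` (Kronecker power of a matrix) and `Matrix.mulVecLin`; highest-weight
statements need a field, and the support statement needs characteristic zero (it is false over
finite fields).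
-/

noncomputable section

open scoped BigOperators TensorProduct

namespace Literature.NumberTheory.DiophantineGeometry

/-- Words of length `m` in the alphabet `Fin N`: the index set of the standard basis
`e_w = e_{w 0} ⊗ ⋯ ⊗ e_{w (m-1)}` of `(k^N)^{⊗m}`. Fulton, *Young Tableaux*, §8.1. [folklore] -/
abbrev Word (N m : ℕ) : Type := Fin m → Fin N

/-! ### The Kronecker power of a matrix and the coordinate representation -/

section Model

variable (k : Type*) [CommRing k] (N m : ℕ)

/-- The `m`-th tensor (Kronecker) power of an `N × N` matrix `g`, as a matrix indexed by words:
entry `(w', w)` is `∏_p g (w' p) (w p)`. Goodman–Wallach §9.1.1; Fulton, *Young Tableaux*, §8.1.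
[folklore] -/
def tensorPowerMatrix (g : Matrix (Fin N) (Fin N) k) : Matrix (Word N m) (Word N m) k :=
  Matrix.of fun w' w => ∏ p, g (w' p) (w p)

/-- Entries of the Kronecker power (unfolding lemma). [folklore] -/
@[simp]
theorem tensorPowerMatrix_apply (g : Matrix (Fin N) (Fin N) k) (w' w : Word N m) :
    tensorPowerMatrix k N m g w' w = ∏ p, g (w' p) (w p) :=
  rfl

/-- The Kronecker power of the identity is the identity. [folklore] -/
theorem tensorPowerMatrix_one : tensorPowerMatrix k N m 1 = 1 := by
  ext w' w
  rw [tensorPowerMatrix_apply, Matrix.one_apply]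
  by_cases h : w' = w
  · subst h
    simp
  · obtain ⟨p, hp⟩ := Function.ne_iff.1 h
    rw [if_neg h]
    exact Finset.prod_eq_zero (Finset.mem_univ p) (Matrix.one_apply_ne hp)

/-- The Kronecker power is multiplicative: `(g h)^{⊗m} = g^{⊗m} h^{⊗m}` (a product of sums is a
sum of products, `Fintype.prod_sum`). [folklore] -/
theorem tensorPowerMatrix_mul (g h : Matrix (Fin N) (Fin N) k) :
    tensorPowerMatrix k N m (g * h) = tensorPowerMatrix k N m g * tensorPowerMatrix k N m h := by
  ext w' w
  simp only [tensorPowerMatrix_apply, Matrix.mul_apply]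
  rw [Fintype.prod_sum]
  refine Finset.sum_congr rfl fun v _ => ?_
  rw [Finset.prod_mul_distrib]

/-- **The coordinate model of `(k^N)^{⊗m}`.** The representation of `GL_N(k)` on functions on
words, `(g · c)(w') = ∑_w (∏_p g_{w' p, w p}) c(w)`: the diagonal action on the tensor power
written in the basis `e_w` (see `wordRepEquiv`). Fulton, *Young Tableaux*, §8.1;
Goodman–Wallach §9.1.1. [folklore] -/
def wordRep : Representation k (GL (Fin N) k) (Word N m → k) where
  toFun g := Matrix.mulVecLin (tensorPowerMatrix k N m (g : Matrix (Fin N) (Fin N) k))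
  map_one' := by
    rw [Units.val_one, tensorPowerMatrix_one, Matrix.mulVecLin_one]
    rfl
  map_mul' g h := by
    rw [Units.val_mul, tensorPowerMatrix_mul, Matrix.mulVecLin_mul]
    rfl

variable {N m}

/-- The action in the coordinate model: `(g · c)(w') = ∑_w (∏_p g_{w' p, w p}) c(w)`.
Fulton, *Young Tableaux*, §8.1. [folklore] -/
theorem wordRep_apply (g : GL (Fin N) k) (c : Word N m → k) (w' : Word N m) :
    wordRep k N m g c w' = ∑ w, (∏ p, (g : Matrix (Fin N) (Fin N) k) (w' p) (w p)) * c w :=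
  rfl

/-- The action on a basis vector `δ_u`: `(g · δ_u)(w') = ∏_p g_{w' p, u p}` (the `u`-th column of
the Kronecker power). Fulton, *Young Tableaux*, §8.1. [folklore] -/
theorem wordRep_single (g : GL (Fin N) k) (u w' : Word N m) :
    wordRep k N m g (Pi.single u 1) w' = ∏ p, (g : Matrix (Fin N) (Fin N) k) (w' p) (u p) := by
  rw [wordRep_apply, Finset.sum_eq_single u]
  · simp
  · intro w _ hw
    simp [hw]
  · intro h
    exact absurd (Finset.mem_univ u) h

end Model

/-! ### The equivalence with `glTensorRep` -/

section Equivalence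

variable (k : Type*) [Field k] (N m : ℕ)

/-- The basis `e_w = e_{w 0} ⊗ ⋯ ⊗ e_{w (m-1)}` of `(k^N)^{⊗m}` indexed by words (Mathlib's
`Basis.piTensorProduct` of the standard bases `Pi.basisFun`). Fulton, *Young Tableaux*, §8.1.
[folklore] -/
def wordBasis : Module.Basis (Word N m) k (TensorPower k m (Fin N → k)) :=
  Basis.piTensorProduct fun _ : Fin m => Pi.basisFun k (Fin N)

/-- Coordinates of a pure tensor: the `w`-th coordinate of `x 0 ⊗ ⋯ ⊗ x (m-1)` is
`∏_p (x p) (w p)`. [folklore] -/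
theorem wordBasis_repr_tprod (x : Fin m → Fin N → k) (w : Word N m) :
    (wordBasis k N m).repr (PiTensorProduct.tprod k x) w = ∏ p, x p (w p) := by
  simp [wordBasis, Basis.piTensorProduct_repr_tprod_apply]

/-- The coordinate isomorphism `(k^N)^{⊗m} ≃ (Word N m → k)` of the basis `wordBasis`.
[folklore] -/
def wordCoord : TensorPower k m (Fin N → k) ≃ₗ[k] (Word N m → k) :=
  (wordBasis k N m).equivFun

/-- Coordinates of a pure tensor (unfolding lemma). [folklore] -/
theorem wordCoord_tprod (x : Fin m → Fin N → k) (w : Word N m) :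
    wordCoord k N m (PiTensorProduct.tprod k x) w = ∏ p, x p (w p) := by
  rw [wordCoord, Module.Basis.equivFun_apply, wordBasis_repr_tprod]

/-- The coordinate isomorphism intertwines `glTensorRep` and `wordRep`: in the basis `e_w` the
diagonal action of `g` is the Kronecker power of `g`. Fulton, *Young Tableaux*, §8.1 (formula for
`g · e_T`); Goodman–Wallach §9.1.1. [folklore] -/
theorem wordCoord_glTensorRep (g : GL (Fin N) k) (v : TensorPower k m (Fin N → k)) :
    wordCoord k N m (glTensorRep (Fin N) k m g v) = wordRep k N m g (wordCoord k N m v) := by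
  induction v using PiTensorProduct.induction_on with
  | smul_tprod r x =>
    simp only [map_smul, glTensorRep_tprod]
    congr 1
    funext w'
    rw [wordCoord_tprod, wordRep_apply]
    simp_rw [wordCoord_tprod, Matrix.mulVec, dotProduct]
    rw [Fintype.prod_sum]
    refine Finset.sum_congr rfl fun w _ => ?_
    rw [Finset.prod_mul_distrib]
  | add u v hu hv => simp only [map_add, hu, hv]

/-- **`glTensorRep ≃ wordRep`.** The equivalence of representations of `GL_N(k)` between the
tensor power `(k^N)^{⊗m}` and its coordinate model. Fulton, *Young Tableaux*, §8.1. [folklore] -/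
def wordRepEquiv : (glTensorRep (Fin N) k m).Equiv (wordRep k N m) :=
  Representation.Equiv.mk (wordCoord k N m) fun g =>
    LinearMap.ext fun v => wordCoord_glTensorRep k N m g v

/-- Highest-weight multiplicities of `(k^N)^{⊗m}` may be computed in the coordinate model.
Goodman–Wallach Cor. 3.2.3 (invariance under equivalence). [folklore] -/
theorem hwMultiplicity_glTensorRep_eq_wordRep (χ : Weight (Fin N)) :
    hwMultiplicity (glTensorRep (Fin N) k m) χ = hwMultiplicity (wordRep k N m) χ :=
  hwMultiplicity_congr (wordRepEquiv k N m) χ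

end Equivalence

/-! ### Content of a word; the action of diagonal matrices; supports of weight vectors -/

section Content

variable {N m : ℕ}

/-- The *content* of a word: `wordContent w i` is the number of positions carrying the letter
`i` (so `e_w` has weight `wordContent w` for the diagonal torus). Fulton, *Young Tableaux*, §2.1
(content of a tableau/word), §8.1. [folklore] -/
def wordContent (w : Word N m) (i : Fin N) : ℕ :=
  (Finset.univ.filter fun p => w p = i).card

/-- A product over the letters of a word, grouped by letter: `∏_p d (w p) = ∏_i d i ^ content_i`.
[folklore] -/
theorem prod_eq_prod_pow_wordContent {M : Type*} [CommMonoid M] (d : Fin N → M) (w : Word N m) :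
    ∏ p, d (w p) = ∏ i, d i ^ wordContent w i := by
  rw [← Finset.prod_fiberwise' Finset.univ w d]
  refine Finset.prod_congr rfl fun i _ => ?_
  rw [Finset.prod_const, wordContent]

/-- The contents of a word of length `m` add up to `m`. [folklore] -/
theorem sum_wordContent (w : Word N m) : ∑ i, wordContent w i = m := by
  have h := Finset.card_eq_sum_card_fiberwise (s := Finset.univ) (t := Finset.univ) (f := w)
    fun _ _ => Finset.mem_univ _
  simpa [wordContent] using h.symm

variable (k : Type*) [Field k]

/-- A diagonal matrix `t = diag(d)` acts on the coordinate model diagonally: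
`(t · c)(w') = (∏_p d (w' p)) c(w')`, i.e. `e_{w'}` is a weight vector of weight `content(w')`.
Fulton, *Young Tableaux*, §8.2 (weights of the `e_T`). [folklore] -/
theorem wordRep_diagonal_apply (d : Fin N → k) (hd : (Matrix.diagonal d).det ≠ 0)
    (c : Word N m → k) (w' : Word N m) :
    wordRep k N m (Matrix.GeneralLinearGroup.mkOfDetNeZero _ hd) c w' = (∏ p, d (w' p)) * c w' := by
  rw [wordRep_apply, Finset.sum_eq_single w']
  · simp [Matrix.GeneralLinearGroup.val_mkOfDetNeZero]
  · intro w _ hw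
    obtain ⟨p, hp⟩ := Function.ne_iff.1 hw
    rw [Finset.prod_eq_zero (Finset.mem_univ p), zero_mul]
    simp [Matrix.GeneralLinearGroup.val_mkOfDetNeZero, Matrix.diagonal_apply_ne _ (Ne.symm hp)]
  · intro h
    exact absurd (Finset.mem_univ w') h

/-- In characteristic zero, integer powers of `2` are distinct. [folklore] -/
theorem two_zpow_injective [CharZero k] : Function.Injective fun n : ℤ => (2 : k) ^ n := by
  intro a b hab
  have h : (algebraMap ℚ k) ((2 : ℚ) ^ a) = (algebraMap ℚ k) ((2 : ℚ) ^ b) := by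
    simpa using hab
  exact zpow_right_injective₀ (by norm_num) (by norm_num) ((algebraMap ℚ k).injective h)

/-- **Weight vectors are supported on words of the right content.** In characteristic zero, if
`c` is a weight vector of weight `χ` in the coordinate model (`t · c = χ(t) c` for all diagonal
`t`), then `c(w) = 0` unless `content(w) = χ`: test with `t = diag(1, …, 2, …, 1)`. (False over
finite fields.) Fulton, *Young Tableaux*, §8.2 (weight space decomposition of `E^{⊗n}`);
Goodman–Wallach §9.1.1. [folklore] -/
theorem apply_eq_zero_of_mem_weightSpace [CharZero k] {χ : Weight (Fin N)} {c : Word N m → k}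
    (hc : c ∈ weightSpace (wordRep k N m) χ) {w : Word N m} {i : Fin N}
    (hw : (wordContent w i : ℤ) ≠ χ i) : c w = 0 := by
  classical
  set d : Fin N → k := fun j => if j = i then 2 else 1 with hd_def
  have hd : (Matrix.diagonal d).det ≠ 0 := by
    rw [Matrix.det_diagonal]
    exact Finset.prod_ne_zero_iff.2 fun j _ => by
      simp only [hd_def]
      split_ifs <;> norm_num
  set t : GL (Fin N) k := Matrix.GeneralLinearGroup.mkOfDetNeZero _ hd with ht_def
  have ht : IsDiagonalGL t :=
    ⟨Matrix.blockTriangular_diagonal d, Matrix.blockTriangular_diagonal d⟩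
  have key := congrFun (hc t ht) w
  rw [ht_def, wordRep_diagonal_apply, Pi.smul_apply, smul_eq_mul, prod_eq_prod_pow_wordContent,
    Finset.prod_eq_single i, weightChar, Finset.prod_eq_single i] at key
  · simp only [Matrix.GeneralLinearGroup.val_mkOfDetNeZero, Matrix.diagonal_apply_eq, hd_def,
      if_true] at key
    rcases mul_eq_mul_right_iff.1 key with h | h
    · exfalso
      apply hw
      apply two_zpow_injective k
      simpa using h
    · exact h
  · intro j _ hj
    simp [Matrix.GeneralLinearGroup.val_mkOfDetNeZero, hd_def, hj]
  · intro h
    exact absurd (Finset.mem_univ i) h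
  · intro j _ hj
    simp [hd_def, hj]
  · intro h
    exact absurd (Finset.mem_univ i) h

/-- A highest-weight vector of weight `χ` in the coordinate model vanishes on words whose content
is not `χ` (characteristic zero). Fulton, *Young Tableaux*, §8.2. [folklore] -/
theorem apply_eq_zero_of_mem_highestWeightSpace [CharZero k] {χ : Weight (Fin N)}
    {c : Word N m → k} (hc : c ∈ highestWeightSpace (wordRep k N m) χ) {w : Word N m} {i : Fin N}
    (hw : (wordContent w i : ℤ) ≠ χ i) : c w = 0 :=
  apply_eq_zero_of_mem_weightSpace k (highestWeightSpace_le_weightSpace _ χ hc) hw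

/-- **Vanishing for weights with a negative entry.** In characteristic zero the coordinate model
(equivalently `(k^N)^{⊗m}`) has no highest-weight vectors of a weight `χ` with some `χ i < 0`
(contents are nonnegative). Fulton, *Young Tableaux*, §8.2. [folklore] -/
theorem highestWeightSpace_wordRep_eq_bot_of_neg [CharZero k] {χ : Weight (Fin N)} {i : Fin N}
    (hi : χ i < 0) : highestWeightSpace (wordRep k N m) χ = ⊥ := by
  rw [Submodule.eq_bot_iff]
  intro c hc
  funext w
  refine apply_eq_zero_of_mem_highestWeightSpace k hc (i := i) ?_
  have : (0 : ℤ) ≤ wordContent w i := Int.natCast_nonneg _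
  omega

end Content

/-! ### The action of `S_m` permuting positions -/

section Perm

variable (k : Type*) [CommRing k] {N m : ℕ}

/-- The action of a permutation `σ ∈ S_m` of the positions on the coordinate model:
`(σ · c)(w) = c(w ∘ σ)`, so that `σ · δ_u = δ_{u ∘ σ⁻¹}` (this is `permTensorRep` in
coordinates). Fulton, *Young Tableaux*, §8.1; Fulton–Harris §6.1. [folklore] -/
def wordPerm (σ : Equiv.Perm (Fin m)) : (Word N m → k) →ₗ[k] (Word N m → k) where
  toFun c w := c (w ∘ σ)
  map_add' _ _ := rfl
  map_smul' _ _ := rfl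

/-- Unfolding lemma for `wordPerm`. [folklore] -/
@[simp]
theorem wordPerm_apply (σ : Equiv.Perm (Fin m)) (c : Word N m → k) (w : Word N m) :
    wordPerm k σ c w = c (w ∘ σ) :=
  rfl

/-- `wordPerm` is multiplicative. [folklore] -/
theorem wordPerm_mul (σ τ : Equiv.Perm (Fin m)) :
    wordPerm k (N := N) (σ * τ) = wordPerm k σ ∘ₗ wordPerm k τ :=
  rfl

/-- `wordPerm 1 = id`. [folklore] -/
theorem wordPerm_one : wordPerm k (N := N) (1 : Equiv.Perm (Fin m)) = LinearMap.id :=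
  rfl

/-- `wordPerm` on a basis vector: `σ · δ_u = δ_{u ∘ σ⁻¹}`. [folklore] -/
theorem wordPerm_single (σ : Equiv.Perm (Fin m)) (u : Word N m) :
    wordPerm k σ (Pi.single u (1 : k)) = Pi.single (u ∘ ⇑σ⁻¹) 1 := by
  funext w
  rw [wordPerm_apply]
  by_cases h : w = u ∘ ⇑σ⁻¹
  · subst h
    have : (u ∘ ⇑σ⁻¹) ∘ ⇑σ = u := by
      funext p
      simp
    rw [this, Pi.single_eq_same, Pi.single_eq_same]
  · rw [Pi.single_eq_of_ne h, Pi.single_eq_of_ne]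
    rintro rfl
    apply h
    funext p
    simp

/-- **The actions of `S_m` and `GL_N` commute** (in coordinates). Fulton–Harris Lemma 6.22;
Fulton, *Young Tableaux*, §8.1. [folklore] -/
theorem wordPerm_wordRep (σ : Equiv.Perm (Fin m)) (g : GL (Fin N) k) (c : Word N m → k) :
    wordPerm k σ (wordRep k N m g c) = wordRep k N m g (wordPerm k σ c) := by
  funext w'
  simp only [wordPerm_apply, wordRep_apply]
  -- reindex the right-hand sum along `w ↦ w ∘ σ`
  let e : Word N m ≃ Word N m :=
    { toFun := fun w => w ∘ ⇑σ
      invFun := fun w => w ∘ ⇑σ⁻¹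
      left_inv := fun w => by funext p; simp
      right_inv := fun w => by funext p; simp }
  symm
  refine Fintype.sum_equiv e _ _ fun w => ?_
  change _ = (∏ p, (g : Matrix (Fin N) (Fin N) k) (w' (σ p)) (w (σ p))) * c (w ∘ ⇑σ)
  rw [Equiv.prod_comp σ (fun q => (g : Matrix (Fin N) (Fin N) k) (w' q) (w q))]

variable {k} in
/-- Highest-weight spaces of the coordinate model are stable under the position permutations
(the two actions commute). Fulton, *Young Tableaux*, §8.1. [folklore] -/
theorem wordPerm_mem_highestWeightSpace {k : Type*} [Field k] (σ : Equiv.Perm (Fin m))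
    {χ : Weight (Fin N)} {c : Word N m → k} (hc : c ∈ highestWeightSpace (wordRep k N m) χ) :
    wordPerm k σ c ∈ highestWeightSpace (wordRep k N m) χ := by
  intro g hg
  rw [← wordPerm_wordRep, hc g hg, map_smul]

end Perm

/-! ### Components along the last tensor factor and the Pieri inequality -/

section Comp

variable (k : Type*) [CommRing k] {N m : ℕ}

/-- The `i`-th *component* of a vector of `(k^N)^{⊗(m+1)}` along the last tensor factor, in
coordinates: `wordComp i c (u) = c (u, i)`, so that `c = ∑_i wordComp i c ⊗ e_i`.
Fulton–Harris §6.1 (`V^{⊗(d)} = V^{⊗(d-1)} ⊗ V`). [folklore] -/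
def wordComp (i : Fin N) : (Word N (m + 1) → k) →ₗ[k] (Word N m → k) where
  toFun c u := c (Fin.snoc u i)
  map_add' _ _ := rfl
  map_smul' _ _ := rfl

/-- Unfolding lemma for `wordComp`. [folklore] -/
@[simp]
theorem wordComp_apply (i : Fin N) (c : Word N (m + 1) → k) (u : Word N m) :
    wordComp k i c u = c (Fin.snoc u i) :=
  rfl

/-- A vector all of whose components vanish is zero. [folklore] -/
theorem eq_zero_of_wordComp_eq_zero (c : Word N (m + 1) → k) (h : ∀ i, wordComp k i c = 0) :
    c = 0 := by
  funext w
  have := congrFun (h (w (Fin.last m))) (Fin.init w)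
  rwa [wordComp_apply, Fin.snoc_init_self] at this

/-- **Components of `g · c`.** `wordComp a (g · c) = ∑_i g_{a i} • g · (wordComp i c)`: the last
tensor factor `e_i` of `c = ∑_i c_i ⊗ e_i` is moved to `g e_i = ∑_a g_{a i} e_a`.
Fulton–Harris §6.1. [folklore] -/
theorem wordComp_wordRep (g : GL (Fin N) k) (c : Word N (m + 1) → k) (a : Fin N) :
    wordComp k a (wordRep k N (m + 1) g c) =
      ∑ i, (g : Matrix (Fin N) (Fin N) k) a i • wordRep k N m g (wordComp k i c) := by
  funext u'
  simp only [wordComp_apply, wordRep_apply, Finset.sum_apply, Pi.smul_apply, smul_eq_mul,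
    Finset.mul_sum]
  rw [← Fintype.sum_prod_type']
  refine Fintype.sum_equiv (Fin.snocEquiv fun _ => Fin N).symm _ _ fun w => ?_
  simp only [Fin.snocEquiv_symm_apply, Fin.snoc_init_self]
  rw [Fin.prod_univ_castSucc]
  simp only [Fin.snoc_castSucc, Fin.snoc_last, Fin.init]
  ring

end Comp

section Pieri

variable {k : Type*} [Field k] {N m : ℕ}

/-- Weight characters are additive in the weight (on upper triangular matrices, whose diagonal
entries are nonzero). Goodman–Wallach §3.1.3. [folklore] -/
theorem weightChar_add {σ : Type*} [Fintype σ] [LinearOrder σ] (χ ψ : Weight σ) {g : GL σ k}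
    (hg : IsUpperTriangular g) : weightChar (χ + ψ) g = weightChar χ g * weightChar ψ g := by
  simp only [weightChar, Pi.add_apply, ← Finset.prod_mul_distrib]
  refine Finset.prod_congr rfl fun i _ => ?_
  rw [zpow_add₀ (diag_ne_zero_of_isUpperTriangular hg i)]

/-- The weight character of `n ε_r` is `g ↦ g_{r r} ^ n`. Goodman–Wallach §3.1.3. [folklore] -/
theorem weightChar_single {σ : Type*} [Fintype σ] [LinearOrder σ] (r : σ) (n : ℤ) (g : GL σ k) :
    weightChar (Pi.single r n) g = (g : Matrix σ σ k) r r ^ n := by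
  rw [weightChar, Finset.prod_eq_single r]
  · rw [Pi.single_eq_same]
  · intro j _ hj
    rw [Pi.single_eq_of_ne hj, zpow_zero]
  · intro h
    exact absurd (Finset.mem_univ r) h

/-- **The top component of a highest-weight vector is a highest-weight vector.** If `c` is a
highest-weight vector of weight `χ` in `(k^N)^{⊗(m+1)}` whose components `wordComp i c` vanish
for `i > r`, then `wordComp r c` is a highest-weight vector of weight `χ - ε_r` in `(k^N)^{⊗m}`:
for upper triangular `g`, `wordComp r (g · c) = g_{r r} • g · wordComp r c`. Pieri's formula for
highest-weight vectors (Fulton–Harris (6.8), Ex. 6.12), elementary form. [folklore] -/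
theorem wordComp_mem_highestWeightSpace {χ : Weight (Fin N)} {c : Word N (m + 1) → k}
    (hc : c ∈ highestWeightSpace (wordRep k N (m + 1)) χ) (r : Fin N)
    (hr : ∀ i, r < i → wordComp k i c = 0) :
    wordComp k r c ∈ highestWeightSpace (wordRep k N m) (χ - Pi.single r 1) := by
  intro g hg
  have h1 : wordComp k r (wordRep k N (m + 1) g c) =
      (g : Matrix (Fin N) (Fin N) k) r r • wordRep k N m g (wordComp k r c) := by
    rw [wordComp_wordRep, Finset.sum_eq_single r]
    · intro i _ hi
      rcases lt_or_gt_of_ne hi with h | h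
      · rw [hg.apply_eq_zero h, zero_smul]
      · rw [hr i h, map_zero, smul_zero]
    · intro h
      exact absurd (Finset.mem_univ r) h
  rw [hc g hg, map_smul] at h1
  have hrr : (g : Matrix (Fin N) (Fin N) k) r r ≠ 0 := diag_ne_zero_of_isUpperTriangular hg r
  have h2 := congrArg (fun x => ((g : Matrix (Fin N) (Fin N) k) r r)⁻¹ • x) h1
  simp only [smul_smul, inv_mul_cancel₀ hrr, one_smul] at h2
  rw [← h2]
  congr 1
  rw [sub_eq_add_neg, weightChar_add _ _ hg, ← Pi.single_neg, weightChar_single, zpow_neg,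
    zpow_one, mul_comm]

variable (k N m)

/-- The filtration of the highest-weight space of weight `χ` of `(k^N)^{⊗(m+1)}` by the largest
nonvanishing component: `compFiltration χ n = {c | wordComp i c = 0 for all i ≥ n}`.
Auxiliary for `finrank_highestWeightSpace_succ_le`. [folklore] -/
def compFiltration (χ : Weight (Fin N)) (n : ℕ) : Submodule k (Word N (m + 1) → k) where
  carrier := {c | c ∈ highestWeightSpace (wordRep k N (m + 1)) χ ∧
    ∀ i : Fin N, n ≤ (i : ℕ) → wordComp k i c = 0}
  add_mem' {a b} ha hb := ⟨Submodule.add_mem _ ha.1 hb.1, fun i hi => by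
    rw [map_add, ha.2 i hi, hb.2 i hi, add_zero]⟩
  zero_mem' := ⟨Submodule.zero_mem _, fun i _ => map_zero _⟩
  smul_mem' r {a} ha := ⟨Submodule.smul_mem _ r ha.1, fun i hi => by
    rw [map_smul, ha.2 i hi, smul_zero]⟩

variable {k N m}

/-- The filtration starts at `0`. [folklore] -/
theorem compFiltration_zero (χ : Weight (Fin N)) : compFiltration k N m χ 0 = ⊥ := by
  rw [Submodule.eq_bot_iff]
  rintro c ⟨-, hc⟩
  exact eq_zero_of_wordComp_eq_zero k c fun i => hc i (Nat.zero_le _)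

/-- The filtration ends at the whole highest-weight space. [folklore] -/
theorem compFiltration_top (χ : Weight (Fin N)) :
    compFiltration k N m χ N = highestWeightSpace (wordRep k N (m + 1)) χ := by
  ext c
  exact ⟨fun h => h.1, fun h => ⟨h, fun i hi => absurd i.2 (not_lt.2 hi)⟩⟩

/-- One step of the filtration costs at most `dim HW_{χ - ε_r}((k^N)^{⊗m})`: the map
`c ↦ wordComp r c` sends the `(r+1)`-st piece to highest-weight vectors of weight `χ - ε_r`
(`wordComp_mem_highestWeightSpace`) with kernel the `r`-th piece. [folklore] -/
theorem finrank_compFiltration_succ_le (χ : Weight (Fin N)) (r : Fin N) :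
    Module.finrank k (compFiltration k N m χ (r + 1)) ≤
      Module.finrank k (compFiltration k N m χ r) +
        Module.finrank k (highestWeightSpace (wordRep k N m) (χ - Pi.single r 1)) := by
  -- the component map on the `(r+1)`-st piece
  let φ : compFiltration k N m χ (r + 1) →ₗ[k]
      highestWeightSpace (wordRep k N m) (χ - Pi.single r 1) :=
    { toFun := fun c => ⟨wordComp k r (c : Word N (m + 1) → k),
        wordComp_mem_highestWeightSpace c.2.1 r fun i hi => c.2.2 i (Nat.succ_le_of_lt hi)⟩
      map_add' := fun _ _ => Subtype.ext (map_add _ _ _)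
      map_smul' := fun _ _ => Subtype.ext (map_smul _ _ _) }
  have hker : (LinearMap.ker φ).map (compFiltration k N m χ (r + 1)).subtype ≤
      compFiltration k N m χ r := by
    rintro _ ⟨c, hc, rfl⟩
    refine ⟨c.2.1, fun i hi => ?_⟩
    rcases hi.eq_or_lt with h | h
    · have hi' : i = r := Fin.ext h.symm
      subst hi'
      exact congrArg Subtype.val (LinearMap.mem_ker.1 hc)
    · exact c.2.2 i (Nat.succ_le_of_lt h)
  have h1 := LinearMap.finrank_range_add_finrank_ker φ
  have h2 : Module.finrank k (LinearMap.range φ) ≤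
      Module.finrank k (highestWeightSpace (wordRep k N m) (χ - Pi.single r 1)) :=
    Submodule.finrank_le _
  have h3 : Module.finrank k (LinearMap.ker φ) ≤ Module.finrank k (compFiltration k N m χ r) := by
    rw [← Submodule.finrank_map_subtype_eq]
    exact Submodule.finrank_mono hker
  omega

/-- **Pieri inequality for highest-weight vectors.**
`dim HW_χ((k^N)^{⊗(m+1)}) ≤ ∑_r dim HW_{χ - ε_r}((k^N)^{⊗m})` for the upper triangular Borel
subgroup of `GL_N(k)`, over any field: filter by the largest nonvanishing component and use
`wordComp_mem_highestWeightSpace`. This is the highest-weight-vector shadow of Pieri's formula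
`V(λ) ⊗ V = ⊕_r V(λ + ε_r)` (Fulton–Harris (6.8); Fulton, *Young Tableaux*, §2.2 (5)).
[folklore] -/
theorem finrank_highestWeightSpace_succ_le (χ : Weight (Fin N)) :
    Module.finrank k (highestWeightSpace (wordRep k N (m + 1)) χ) ≤
      ∑ r : Fin N, Module.finrank k (highestWeightSpace (wordRep k N m) (χ - Pi.single r 1)) := by
  -- by induction along the filtration
  have key : ∀ n : ℕ, n ≤ N → Module.finrank k (compFiltration k N m χ n) ≤
      ∑ r ∈ Finset.univ.filter (fun r : Fin N => (r : ℕ) < n),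
        Module.finrank k (highestWeightSpace (wordRep k N m) (χ - Pi.single r 1)) := by
    intro n
    induction n with
    | zero =>
      intro _
      rw [compFiltration_zero, finrank_bot]
      exact Nat.zero_le _
    | succ n ih =>
      intro hn
      have hn' : n < N := hn
      have step := finrank_compFiltration_succ_le (k := k) (m := m) χ ⟨n, hn'⟩
      have hfilter : Finset.univ.filter (fun r : Fin N => (r : ℕ) < n + 1) =
          insert ⟨n, hn'⟩ (Finset.univ.filter fun r : Fin N => (r : ℕ) < n) := by
        ext r
        simp only [Finset.mem_filter, Finset.mem_univ, true_and, Finset.mem_insert, Fin.ext_iff]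
        omega
      rw [hfilter, Finset.sum_insert (by simp)]
      have := ih hn'.le
      simp only at step
      omega
  have := key N le_rfl
  rw [compFiltration_top] at this
  refine this.trans (le_of_eq (Finset.sum_congr ?_ fun _ _ => rfl))
  ext r
  simp

end Pieri

end Literature.NumberTheory.DiophantineGeometry
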